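import Literature.AlgebraicGeometry.HodgeTheory.SpreadSupportsDominantFamily
import Literature.AlgebraicGeometry.HodgeTheory.ClassesSupportedOn
import Literature.AlgebraicGeometry.HodgeTheory.AlgebraicityLocusFromFacts
import Literature.AlgebraicGeometry.HodgeTheory.AlgebraicityLocusFromMumfordVerdier
import Literature.AlgebraicGeometry.Motives.VerdierGenericLocalTriviality
import HarnessLib

/-!
# Spreading supports over a curve, II: the spread set over a cofinite open of the base curve

Topic `Literature/AlgebraicGeometry/HodgeTheory` (family `hodge`). Second proof file towards the
named fact `spread_supports_over_smoothCurve` (`SpreadSupportsOverCurve.lean`; Voisin, *Hodge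
Theory II*, §3.3.1 and proof of Thm. 10.19; Charles–Schnell, proof of Prop. 11.3.11), continuing
`SpreadSupportsDominantFamily`, in the architecture of the tree's structure theorem on algebraicity
loci (`AlgebraicityLocusAssembly`: countably many proper parameter `S`-schemes `h_i : H_i ⟶ S` with
Zariski-closed families of supports `𝒵_i ⊆ 𝒳 × H_i`, good sets, completeness, generic dichotomy).

* `exists_isClosed_spread_of_dichotomy` — **the spread set**: for a `ℂ`-morphism `f : 𝒳 ⟶ S` to a
  smooth integral quasi-projective CURVE all of whose complex points are good-witnessed, a
  non-empty open `O₀ ⊆ S` and a Zariski-closed `Z ⊆ 𝒳` such that over every complex point `u` of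
  `O₀` the slice `ι_u⁻¹ Z ⊆ 𝒳_u` has dimension `≤ n - p` pointwise and the class `A|_{𝒳_u}` dies off
  it. Construction (Voisin, *Hodge Theory II*, proof of Thm. 10.19, with supports in place of the
  universal cycle): the irreducible multisection curve `D ⊆ Y ⊆ H_i` of
  `exists_irreducible_curve_subset` inside a dominating good parameter variety
  (`exists_dominant_good`); `Z` is the image of `𝒵_i ∩ (𝒳 ×_S D)` under the PROPER projection
  `𝒳 ×_S H_i → 𝒳` (closed), `O₀` the complement of the (closed) image in `S` of the bad points
  `D ∖ O`. Over a complex point `u` of `O₀` every point of `D` is a GOOD closed point, so the slice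
  of `Z` over `u` is a union of good slices (dimension bound) and contains the good slice over any
  point of `D` above `u` (`D → S` is onto), off which `A|_{𝒳_u}` dies. No smoothness or flatness of
  `f` and no limit argument is needed at this stage.
* `exists_isClosed_spread_of_verdier` — the same conclusion for `f : 𝒳 ⟶ S` PROPER with `𝒳`
  quasi-projective, fibres over complex points smooth projective `n`-folds and `A` algebraic on
  every fibre, GRANTED Verdier's generic local triviality of pairs `hGT` (Verdier 1976, Thm. (2.2)
  + (3.3) + (4.14), Cor. (5.1); the inline hypothesis of `AlgebraicityLocusFromFacts`): the
  hyperplane witness families of `AlgebraicityLocusWitnesses` (complete: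
  `exists_tuplePoint_forall_mem_iff`) with their generic dichotomy from `hGT`
  (`pairTrivialisation_of_genericPairTriviality`, `dichotomy_of_pairTrivialisation`,
  `codim_dichotomy_of_isPreimmersion` — none of which uses smoothness of the morphism `f`).
  Mumford's curve lemma enters proved (`Motives.mumford_smoothCurve_through_two_points_holds`).

## References

* [VoisinHodgeII2003] C. Voisin, Hodge Theory and Complex Algebraic Geometry II (2003), §3.3.1;
  §10.2.1, proof of Thm. 10.19.
* [CharlesSchnell2014Notes] F. Charles, C. Schnell, Notes on absolute Hodge classes (2014),
  Prop. 11.3.11 (proof).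
* [Verdier1976] J.-L. Verdier, Stratifications de Whitney et théorème de Bertini–Sard, Invent.
  Math. 36 (1976), Thm. (3.3), Thm. (4.14), Cor. (5.1).
-/

noncomputable section

open CategoryTheory AlgebraicGeometry Limits Set Order MonoidalCategory CartesianMonoidalCategory
open _root_.Topology TopologicalSpace Filter
open Literature.AlgebraicGeometry.Motives Literature.AlgebraicGeometry.Motives.ProjectiveSpace

universe u

namespace Literature.AlgebraicGeometry.HodgeTheory

section HodgeTheory

section SpreadSet

variable {𝒳 S : Motives.SchemeOver ℂ} (f : 𝒳 ⟶ S)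

/-! ### Points of a fibre lie over the complex point -/

/-- A point of the fibre `𝒳_u` maps to the point of `S` under `u`. [folklore] -/
theorem apply_fiberι_base_eq_pt (u : Motives.ComplexPoints S) (m : (Motives.fiberOver f u).left) :
    f.left.base ((Motives.fiberι f u).left.base m) = u.pt := by
  have h := congrArg (fun φ => φ.left.base m) (Motives.fiberι_comp f u)
  simp only [Over.comp_left, Scheme.Hom.comp_base, TopCat.coe_comp, Function.comp_apply] at h
  rw [h]
  change u.left.base _ = u.left.base (IsLocalRing.closedPoint ℂ)
  exact congrArg u.left.base (Subsingleton.elim (α := PrimeSpectrum ℂ) _ _)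

/-! ### The slice morphism through the fibre product -/

/-- The slice morphism `(ι_u, y) : 𝒳_u ⟶ 𝒳 × H` of a complex point `y` of `H` over `u` factors
through the fibre product: `(ι_u, y) = lift (ι_u, y) ≫ toProd`. [folklore] -/
theorem pullbackOverLift_toProd {H : Motives.SchemeOver ℂ} (h : H ⟶ S)
    (u : Motives.ComplexPoints S) (y : Motives.ComplexPoints H) (hyu : y ≫ h = u) :
    pullbackOver.lift (f := f) (g := h) (Motives.fiberι f u) (Motives.fiberOverToSpec f u ≫ y)
        (by rw [Motives.fiberι_comp, Category.assoc, hyu]) ≫ pullbackOver.toProd f h =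
      lift (Motives.fiberι f u) (Motives.fiberOverToSpec f u ≫ y) := by
  refine CartesianMonoidalCategory.hom_ext _ _ ?_ ?_
  · rw [Category.assoc, pullbackOver.toProd_fst, pullbackOver.lift_fst, lift_fst]
  · rw [Category.assoc, pullbackOver.toProd_snd, pullbackOver.lift_snd, lift_snd]

/-! ### The spread set -/

/-- **The spread set over a cofinite open of the base curve.** Let `f : 𝒳 ⟶ S` be a `ℂ`-morphism
to a smooth integral quasi-projective curve `S`, `A ∈ H²ᵖ(𝒳(ℂ); ℂ)`, and `h_i : H_i ⟶ S` countably
many PROPER parameter schemes with closed families of supports `𝒵_i ⊆ 𝒳 × H_i` and good sets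
`Good_i ⊆ H_i(ℂ)` — a good `y` has a slice `(𝒵_i)_y` all of whose points `x` satisfy
`height x + p ≤ n` and off which `A|_{𝒳_{h_i(y)}}` dies — such that EVERY complex point of `S` lies
under a good point (`hall`) and the generic dichotomy holds on irreducible closed subsets of the
`H_i` (`hdich`). Then there are a non-empty open `O° ⊆ S` and a Zariski-closed `Z ⊆ 𝒳` such that
for every complex point `u` of `O°`, every point `m` of the fibre `𝒳_u` with `ι_u m ∈ Z` has
`height m + p ≤ n`, and `A|_{𝒳_u}` dies off `ι_u⁻¹ Z`. Proof: the multisection curve `D ⊆ Y ⊆ H_i`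
with generic point `ξ ∈ O` over the generic point of `S` (`exists_dominant_good`,
`exists_irreducible_curve_subset`); `Z := pr_𝒳(toProd⁻¹ 𝒵_i ∩ pr_H⁻¹ D)` for the proper projection
`pr_𝒳 : 𝒳 ×_S H_i ⟶ 𝒳`; `O° := S ∖ h_i(D ∖ O)` (the image of a closed set under a proper map is
closed; it misses the generic point). Over `u ∈ O°(ℂ)` a point of `D` is closed, good, and the point
of a complex point `y` over `u`; a point of `Z` over `u` lies in the slice `(𝒵_i)_y` of such a `y`
(points of `𝒳 × H_i` over `pt y` are slices), whence the height bound; and `D → S` being onto, the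
slice `(𝒵_i)_y ⊆ ι_u⁻¹ Z` of one such `y` carries `A|_{𝒳_u}` (`classesSupportedOn_mono`).
[cite: VoisinHodgeII2003, §10.2.1 (proof of Thm. 10.19)]
[cite: CharlesSchnell2014Notes, Prop. 11.3.11 (proof)] -/
theorem exists_isClosed_spread_of_dichotomy [IsIntegral S.left] [SmoothOfRelativeDimension 1 S.hom]
    (hS : IsQuasiProjectiveOver S) {n : ℕ} (p : ℕ) (A : complexBetti 𝒳 (2 * p)) {ι : Type}
    [Countable ι] (H : ι → Motives.SchemeOver ℂ) (h : ∀ i, H i ⟶ S) [∀ i, IsProper (h i).left]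
    (𝒵 : ∀ i, Set (𝒳 ⊗ H i).left) (h𝒵 : ∀ i, IsClosed (𝒵 i))
    (Good : ∀ i, Set (Motives.ComplexPoints (H i)))
    (hGood : ∀ i (y : Motives.ComplexPoints (H i)), y ∈ Good i →
      (∀ x : 𝒳.left, (sliceAt 𝒳 y).left.base x ∈ 𝒵 i → height x + p ≤ (n : ℕ∞)) ∧
      complexBetti.map (Motives.fiberι f (AlgPoints.map (h i) y)) (2 * p) A ∈
        LinearMap.ker (complexBetti.restrictCompl (Motives.fiberOver f (AlgPoints.map (h i) y))
          ((lift (Motives.fiberι f (AlgPoints.map (h i) y))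
            (Motives.fiberOverToSpec f (AlgPoints.map (h i) y) ≫ y)).left.base ⁻¹' 𝒵 i)
              (2 * p)).hom)
    (hall : ∀ t : Motives.ComplexPoints S, ∃ i, ∃ y ∈ Good i, y ≫ h i = t)
    (hdich : ∀ i (Y : Set (H i).left), IsClosed Y → IsIrreducible Y →
      ∃ O : Set (H i).left, IsOpen O ∧ (O ∩ Y).Nonempty ∧
        ((∀ y : Motives.ComplexPoints (H i), y.pt ∈ O ∩ Y → y ∈ Good i) ∨
          (∀ y : Motives.ComplexPoints (H i), y.pt ∈ O ∩ Y → y ∉ Good i))) :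
    ∃ O₀ : S.left.Opens, (O₀ : Set S.left).Nonempty ∧ ∃ Z : Set 𝒳.left, IsClosed Z ∧
      ∀ u : Motives.ComplexPoints S, u.pt ∈ O₀ →
        (∀ m : (Motives.fiberOver f u).left, (Motives.fiberι f u).left.base m ∈ Z →
          height m + p ≤ (n : ℕ∞)) ∧
        complexBetti.restrictCompl (Motives.fiberOver f u) ((Motives.fiberι f u).left.base ⁻¹' Z)
          (2 * p) (complexBetti.map (Motives.fiberι f u) (2 * p) A) = 0 := by
  haveI : Smooth S.hom := SmoothOfRelativeDimension.smooth 1 S.hom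
  haveI : LocallyOfFiniteType S.hom := inferInstance
  haveI : ∀ i, NoetherianSpace (H i).left := fun i =>
    noetherianSpace_of_isProper_of_isQuasiProjectiveOver (h i) hS
  haveI : ∀ i, LocallyOfFiniteType (H i).hom := fun i => by
    rw [← Over.w (h i)]
    infer_instance
  -- a dominating good parameter variety and a multisection curve in it
  obtain ⟨i, Y, hYc, hY, O, hOo, hOY, hOgood, hdom⟩ := exists_dominant_good H h Good hall hdich
  obtain ⟨D, ξ, hDc, hξD, hDY, hξO, hξtop, hDcl⟩ :=
    exists_irreducible_curve_subset (h i) hYc hY hOo hOY hdom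
  haveI : LocallyOfFiniteType (h i).left := inferInstance
  -- a point of `D` over a complex point `u` is the point of a GOOD complex point over `u`,
  -- provided `u` is not under a bad point of `D`
  set B : Set (H i).left := D ∩ Oᶜ with hB
  have hBc : IsClosed B := hDc.inter hOo.isClosed_compl
  have hlift : ∀ (u : Motives.ComplexPoints S) (x : (H i).left), x ∈ D →
      (h i).left.base x = u.pt → u.pt ∉ (h i).left.base '' B →
      ∃ y : Motives.ComplexPoints (H i), y ≫ h i = u ∧ y.pt = x ∧ y ∈ Good i := by
    intro u x hxD hxu huB
    have hxξ : x ≠ ξ := by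
      intro he
      rw [he, hξtop] at hxu
      exact pt_ne_top_of_smoothCurve u hxu.symm
    obtain ⟨y, hyu, hyx⟩ := exists_complexPoint_comp_eq_of_pt_mem (h i) u (hDcl x hxD hxξ)
      (Set.mem_singleton x) hxu
    rw [Set.mem_singleton_iff] at hyx
    have hxO : x ∈ O := by
      by_contra hxO
      exact huB ⟨x, ⟨hxD, hxO⟩, hxu⟩
    exact ⟨y, hyu, hyx, hOgood y ⟨hyx ▸ hxO, hDY (hyx ▸ hxD)⟩⟩
  -- the open `O₀ = S ∖ h(B)`, non-empty as it contains the generic point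
  have hBim : IsClosed ((h i).left.base '' B) := (h i).left.isClosedMap _ hBc
  have htop : (⊤ : S.left) ∉ (h i).left.base '' B := by
    rintro ⟨x, ⟨hxD, hxO⟩, hx⟩
    have hxξ : x ≠ ξ := fun he => hxO (he ▸ hξO)
    set yx := (Motives.ComplexPoints.equivClosedPoints (H i)).symm ⟨x, hDcl x hxD hxξ⟩ with hyx
    have hyxpt : yx.pt = x := by
      have h1 := Motives.ComplexPoints.coe_equivClosedPoints_apply (H i) yx
      rw [hyx, Equiv.apply_symm_apply] at h1
      exact h1.symm
    apply pt_ne_top_of_smoothCurve (yx ≫ h i)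
    change (h i).left.base yx.pt = ⊤
    rw [hyxpt, hx]
  -- the spread set: push `toProd⁻¹ 𝒵 ∩ pr_H⁻¹ D` forward along the proper `pr_𝒳 : 𝒳 ×_S H ⟶ 𝒳`
  set P := pullbackOver f (h i) with hP
  set T : P.left → (𝒳 ⊗ H i).left := fun z => (pullbackOver.toProd f (h i)).left.base z
    with hT
  set G : Set P.left := T ⁻¹' 𝒵 i ∩ (pullbackOver.snd f (h i)).left.base ⁻¹' D with hG
  have hGc : IsClosed G :=
    ((h𝒵 i).preimage (pullbackOver.toProd f (h i)).left.continuous).inter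
      (hDc.preimage (pullbackOver.snd f (h i)).left.continuous)
  haveI : IsProper (pullbackOver.fst f (h i)).left := by
    change IsProper (pullback.fst f.left (h i).left)
    infer_instance
  set Z : Set 𝒳.left := (pullbackOver.fst f (h i)).left.base '' G with hZ
  have hZc : IsClosed Z := (pullbackOver.fst f (h i)).left.isClosedMap _ hGc
  -- the two projections of a point of `P` agree on `S`
  have hcond : ∀ z : P.left,
      f.left.base ((pullbackOver.fst f (h i)).left.base z) =
        (h i).left.base ((pullbackOver.snd f (h i)).left.base z) := fun z => by
    have h1 := congrArg (fun φ => φ.left.base z) (pullbackOver.condition f (h i))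
    simpa only [Over.comp_left, Scheme.Hom.comp_base, TopCat.coe_comp, Function.comp_apply] using h1
  -- the two projections of `T z`
  have hTfst : ∀ z : P.left, (CartesianMonoidalCategory.fst 𝒳 (H i)).left.base (T z) =
      (pullbackOver.fst f (h i)).left.base z := fun z => by
    have h1 := congrArg (fun φ => φ.left.base z) (pullbackOver.toProd_fst f (h i))
    simpa only [Over.comp_left, Scheme.Hom.comp_base, TopCat.coe_comp, Function.comp_apply] using h1
  have hTsnd : ∀ z : P.left, (CartesianMonoidalCategory.snd 𝒳 (H i)).left.base (T z) =
      (pullbackOver.snd f (h i)).left.base z := fun z => by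
    have h1 := congrArg (fun φ => φ.left.base z) (pullbackOver.toProd_snd f (h i))
    simpa only [Over.comp_left, Scheme.Hom.comp_base, TopCat.coe_comp, Function.comp_apply] using h1
  refine ⟨⟨((h i).left.base '' B)ᶜ, hBim.isOpen_compl⟩, ⟨⊤, htop⟩, Z, hZc, fun u hu => ⟨?_, ?_⟩⟩
  · -- the dimension bound: a point of `Z` over `u` lies in a good slice
    intro m hm
    obtain ⟨z, ⟨hz𝒵, hzD⟩, hzm⟩ := hm
    have hxu : (h i).left.base ((pullbackOver.snd f (h i)).left.base z) = u.pt := by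
      rw [← hcond z, hzm, apply_fiberι_base_eq_pt]
    obtain ⟨y, hyu, hypt, hy⟩ := hlift u _ hzD hxu hu
    -- `T z` is the slice `i_y (ι_u m)`
    obtain ⟨x', hx'⟩ := exists_sliceAt_base_eq (𝒳 := 𝒳) y (T z) (by rw [hTsnd, hypt])
    have hx'eq : x' = (Motives.fiberι f u).left.base m := by
      have h1 := congrArg (fun φ => φ.left.base x') (sliceAt_fst 𝒳 y)
      simp only [Over.comp_left, Scheme.Hom.comp_base, TopCat.coe_comp, Function.comp_apply,
        Over.id_left, Scheme.Hom.id_base, TopCat.coe_id, id_eq] at h1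
      rw [← h1, hx', hTfst, hzm]
    have hslice : (sliceAt 𝒳 y).left.base ((Motives.fiberι f u).left.base m) ∈ 𝒵 i := by
      rw [← hx'eq, hx']
      exact hz𝒵
    have hbound := (hGood i y hy).1 _ hslice
    rwa [height_fiberι_base_eq f u m] at hbound
  · -- dying off: `D → S` is onto, so some good `y` over `u` has its slice inside `ι_u⁻¹ Z`
    have hDim : (h i).left.base '' D = Set.univ := by
      have hc : IsClosed ((h i).left.base '' D) := (h i).left.isClosedMap _ hDc
      refine Set.eq_univ_of_univ_subset ?_
      have h1 : closure {(⊤ : S.left)} ⊆ (h i).left.base '' D :=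
        closure_minimal (Set.singleton_subset_iff.2 ⟨ξ, hξD.mem, hξtop⟩) hc
      rwa [show closure {(⊤ : S.left)} = Set.univ from (genericPoint_spec S.left).def] at h1
    obtain ⟨x, hxD, hxu⟩ : u.pt ∈ (h i).left.base '' D := hDim ▸ Set.mem_univ _
    obtain ⟨y, hyu, hypt, hy⟩ := hlift u x hxD hxu hu
    subst hyu
    have hgood := (hGood i y hy).2
    -- the good slice lies in `ι_u⁻¹ Z`
    have hsub : (lift (Motives.fiberι f (AlgPoints.map (h i) y))
        (Motives.fiberOverToSpec f (AlgPoints.map (h i) y) ≫ y)).left.base ⁻¹' 𝒵 i ⊆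
        (Motives.fiberι f (AlgPoints.map (h i) y)).left.base ⁻¹' Z := by
      intro m hm
      set lz := pullbackOver.lift (f := f) (g := h i) (Motives.fiberι f (AlgPoints.map (h i) y))
        (Motives.fiberOverToSpec f (AlgPoints.map (h i) y) ≫ y)
        (by rw [Motives.fiberι_comp, Category.assoc]; rfl) with hlz
      refine ⟨lz.left.base m, ⟨?_, ?_⟩, ?_⟩
      · -- `T (lz m) = (ι_u, y) m ∈ 𝒵 i`
        change (lz ≫ pullbackOver.toProd f (h i)).left.base m ∈ 𝒵 i
        rw [hlz, pullbackOverLift_toProd f (h i) (AlgPoints.map (h i) y) y rfl]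
        exact hm
      · -- `pr_H (lz m) = pt y ∈ D`
        change (lz ≫ pullbackOver.snd f (h i)).left.base m ∈ D
        rw [hlz, pullbackOver.lift_snd]
        change y.left.base ((Motives.fiberOverToSpec f (AlgPoints.map (h i) y)).left.base m) ∈ D
        rw [show y.left.base ((Motives.fiberOverToSpec f (AlgPoints.map (h i) y)).left.base m) =
            y.pt from congrArg y.left.base (Subsingleton.elim (α := PrimeSpectrum ℂ) _ _), hypt]
        exact hxD
      · change (lz ≫ pullbackOver.fst f (h i)).left.base m = _
        rw [hlz, pullbackOver.lift_fst]
    have hmono := classesSupportedOn_mono hsub (2 * p) hgood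
    exact (mem_classesSupportedOn_iff.1 hmono)

end SpreadSet

section FromVerdier

/-- **The spread set from Verdier's generic local triviality.** Let `f : 𝒳 ⟶ S` be proper, `𝒳`
quasi-projective over `ℂ`, `S` a smooth integral quasi-projective curve, such that the fibre of `f`
over every complex point of `S` is a smooth projective `n`-fold, and let `A ∈ H²ᵖ(𝒳(ℂ); ℂ)` be
algebraic on every such fibre. Granted Verdier's generic local triviality of pairs (`hGT`), there
are a non-empty open `O₀ ⊆ S` and a Zariski-closed `Z ⊆ 𝒳` such that for every complex point `u`
of `O₀`, every point `m` of `𝒳_u` with `ι_u m ∈ Z` has `height m + p ≤ n` and `A|_{𝒳_u}` dies off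
`ι_u⁻¹ Z`. Proof: the countable hyperplane witness families `hyperplaneFamily f ε d m` for a
projective embedding `ε` of `𝒳` are complete (every algebraic `A|_{𝒳_t}` dies off a codimension-`p`
slice); on their (proper, Noetherian) parameter spaces the dimension condition is generically
uniform (`codim_dichotomy_of_isPreimmersion`) and the vanishing condition generically constant
(`dichotomy_of_pairTrivialisation` on Verdier's trivialisations,
`pairTrivialisation_of_genericPairTriviality`); conclude by `exists_isClosed_spread_of_dichotomy`.
[cite: VoisinHodgeII2003, §3.3.1 and §10.2.1 (proof of Thm. 10.19)]
[cite: CharlesSchnell2014Notes, Prop. 11.3.11 (proof)]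
[cite: Verdier1976, Thm. (3.3), Thm. (4.14), Cor. (5.1)] -/
theorem exists_isClosed_spread_of_verdier
    (hGT : Verdier1976_genericLocalTriviality)
    {𝒳 S : Motives.SchemeOver ℂ} (f : 𝒳 ⟶ S) [IsIntegral S.left]
    [SmoothOfRelativeDimension 1 S.hom] (hS : IsQuasiProjectiveOver S)
    (h𝒳 : IsQuasiProjectiveOver 𝒳) [IsProper f.left] {n : ℕ} (p : ℕ)
    (hfib : ∀ t : Motives.ComplexPoints S, Motives.IsSmoothProjective n (Motives.fiberOver f t))
    (A : complexBetti 𝒳 (2 * p))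
    (halg : ∀ t : Motives.ComplexPoints S,
      complexBetti.map (Motives.fiberι f t) (2 * p) A ∈ algebraicClasses (Motives.fiberOver f t) p) :
    ∃ O₀ : S.left.Opens, (O₀ : Set S.left).Nonempty ∧ ∃ Z : Set 𝒳.left, IsClosed Z ∧
      ∀ u : Motives.ComplexPoints S, u.pt ∈ O₀ →
        (∀ m : (Motives.fiberOver f u).left, (Motives.fiberι f u).left.base m ∈ Z →
          height m + p ≤ (n : ℕ∞)) ∧
        complexBetti.restrictCompl (Motives.fiberOver f u) ((Motives.fiberι f u).left.base ⁻¹' Z)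
          (2 * p) (complexBetti.map (Motives.fiberι f u) (2 * p) A) = 0 := by
  -- the standing instances
  haveI : Smooth S.hom := SmoothOfRelativeDimension.smooth 1 S.hom
  haveI : LocallyOfFiniteType S.hom := inferInstance
  obtain ⟨P', j', hP', hj'⟩ := hS
  haveI : IsProper P'.hom := hP'.isProper
  haveI : IsSeparated S.hom := by
    rw [show S.hom = j'.left ≫ P'.hom from (Over.w j').symm]
    infer_instance
  have hS : IsQuasiProjectiveOver S := ⟨P', j', hP', hj'⟩
  haveI : IsSeparated 𝒳.hom := by
    rw [show 𝒳.hom = f.left ≫ S.hom from (Over.w f).symm]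
    infer_instance
  -- the embedding `ε : 𝒳 ⟶ ℙᴺ` (open immersion into a projective scheme, then its embedding)
  obtain ⟨P, j, hP, hj⟩ := h𝒳
  obtain ⟨N, ι, hι⟩ := hP
  haveI := hj
  haveI := hι
  set ε : 𝒳 ⟶ projectiveSpace N ℂ := j ≫ ι with hεdef
  have hε : IsEmbedding ε.left.base := by
    rw [hεdef, Over.comp_left, Scheme.Hom.comp_base, TopCat.coe_comp]
    exact ι.left.isClosedEmbedding.isEmbedding.comp j.left.isOpenEmbedding.isEmbedding
  haveI hεpre : IsPreimmersion ε.left := by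
    rw [hεdef, Over.comp_left]
    infer_instance
  -- the witness families, indexed by `(d, m)`
  let H : ℕ × ℕ → Motives.SchemeOver ℂ := fun i => (hyperplaneFamily f ε i.1 i.2).T
  let h : ∀ i, H i ⟶ S := fun i => (hyperplaneFamily f ε i.1 i.2).h
  let 𝒵 : ∀ i, Set (𝒳 ⊗ H i).left := fun i => (hyperplaneFamily f ε i.1 i.2).𝒵
  haveI : ∀ i, IsProper (h i).left := fun i => isProper_hyperplaneFamily_h f ε i.1 i.2
  haveI hlft : ∀ i, LocallyOfFiniteType (H i).hom := fun i => by
    rw [← Over.w (h i)]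
    infer_instance
  -- the good sets: slices of dimension `≤ n - p` pointwise off which `A` dies
  let Good : ∀ i, Set (Motives.ComplexPoints (H i)) := fun i =>
    {y | (∀ x : 𝒳.left, (sliceAt 𝒳 y).left.base x ∈ 𝒵 i → height x + p ≤ (n : ℕ∞)) ∧
      complexBetti.map (Motives.fiberι f (AlgPoints.map (h i) y)) (2 * p) A ∈
        LinearMap.ker (complexBetti.restrictCompl (Motives.fiberOver f (AlgPoints.map (h i) y))
          ((lift (Motives.fiberι f (AlgPoints.map (h i) y))
            (Motives.fiberOverToSpec f (AlgPoints.map (h i) y) ≫ y)).left.base ⁻¹' 𝒵 i)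
              (2 * p)).hom}
  refine exists_isClosed_spread_of_dichotomy f hS p A H h 𝒵
    (fun i => isClosed_hyperplaneFamily_𝒵 f ε i.1 i.2) Good (fun i y hy => hy) ?_ ?_
  · -- completeness of the witnesses: every complex point is good-witnessed
    intro t
    obtain ⟨Zt, hZc, hZp, hZ0⟩ := mem_supportedClasses_iff_exists.1 (halg t)
    obtain ⟨d, m, y, hyt, hZy⟩ := exists_tuplePoint_forall_mem_iff f ε hε t hZc
    refine ⟨(d, m), y, ?_, hyt⟩
    subst hyt
    refine ⟨fun x hx => ?_, ?_⟩
    · -- dimension: `x` lies over `h(y)`, is `ι_t z` with `z ∈ Zt`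
      have hfx : f.left.base x = (AlgPoints.map (hyperplaneFamily f ε d m).h y).pt :=
        apply_eq_pt_of_sliceAt_mem_hyperplaneFamily_𝒵 f ε d m y x hx
      obtain ⟨z, rfl⟩ := exists_fiberι_base_eq f _ x hfx
      have hz : z ∈ Zt := (hZy z).2 hx
      rw [height_fiberι_base_eq f _ z, ← le_coheight_iff_height_add_le (hfib _) z p]
      exact hZp z hz
    · -- dies off the slice, which is `Zt`
      have hslice : (lift (Motives.fiberι f (AlgPoints.map (hyperplaneFamily f ε d m).h y))
          (Motives.fiberOverToSpec f (AlgPoints.map (hyperplaneFamily f ε d m).h y) ≫ y)).left.base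
            ⁻¹' (hyperplaneFamily f ε d m).𝒵 = Zt := by
        ext z
        rw [Set.mem_preimage, lift_fiberι_base_apply]
        exact (hZy z).symm
      change complexBetti.map (Motives.fiberι f (AlgPoints.map (hyperplaneFamily f ε d m).h y))
          (2 * p) A ∈
        LinearMap.ker (complexBetti.restrictCompl
          (Motives.fiberOver f (AlgPoints.map (hyperplaneFamily f ε d m).h y))
          ((lift (Motives.fiberι f (AlgPoints.map (hyperplaneFamily f ε d m).h y))
            (Motives.fiberOverToSpec f (AlgPoints.map (hyperplaneFamily f ε d m).h y) ≫
              y)).left.base ⁻¹' (hyperplaneFamily f ε d m).𝒵) (2 * p)).hom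
      rw [hslice]
      exact LinearMap.mem_ker.2 hZ0
  · -- the generic dichotomy on irreducible closed subsets of the parameter spaces
    rintro ⟨d, m⟩ Y hYc hY
    haveI : LocallyOfFiniteType (hyperplaneFamily f ε d m).T.hom := hlft (d, m)
    haveI : IsProper (hyperplaneFamily f ε d m).h.left := isProper_hyperplaneFamily_h f ε d m
    haveI : IsSeparated (hyperplaneFamily f ε d m).T.hom := by
      rw [← Over.w (hyperplaneFamily f ε d m).h]
      infer_instance
    haveI : NoetherianSpace (hyperplaneFamily f ε d m).T.left :=
      noetherianSpace_of_isProper_of_isQuasiProjectiveOver (hyperplaneFamily f ε d m).h hS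
    obtain ⟨OV, hYOV, hVO⟩ := pairTrivialisation_of_genericPairTriviality f
      (hyperplaneFamily f ε d m).h hGT (hyperplaneFamily f ε d m).𝒵
      (isClosed_hyperplaneFamily_𝒵 f ε d m) hYc hY
    obtain ⟨OC, hYOC, hCO⟩ := codim_dichotomy_of_isPreimmersion f (hyperplaneFamily f ε d m).h ε
      (isClosed_hyperplaneFamily_𝒵 f ε d m) (apply_eq_pt_of_sliceAt_mem_hyperplaneFamily_𝒵 f ε d m)
      p n hY
    have hYO : (Y ∩ ((OV ⊓ OC : (hyperplaneFamily f ε d m).T.left.Opens) : Set _)).Nonempty := by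
      obtain ⟨q, hqY, hq⟩ := hY.isPreirreducible _ _ OV.2 OC.2
        (by obtain ⟨q, hqY, hq⟩ := hYOV; exact ⟨q, hqY, hq⟩)
        (by obtain ⟨q, hqY, hq⟩ := hYOC; exact ⟨q, hqY, hq⟩)
      exact ⟨q, hqY, hq⟩
    refine ⟨((OV ⊓ OC : (hyperplaneFamily f ε d m).T.left.Opens) : Set _), (OV ⊓ OC).2, ?_, ?_⟩
    · obtain ⟨q, hqY, hq⟩ := hYO
      exact ⟨q, hq, hqY⟩
    rcases hCO with hgoodC | hbadC
    · have hdich := dichotomy_of_pairTrivialisation f (hyperplaneFamily f ε d m).h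
        (hyperplaneFamily f ε d m).𝒵 (2 * p) A hYc hY (OV ⊓ OC) hYO
        (hVO (OV ⊓ OC) inf_le_left)
      rcases hdich with hall | hnone
      · refine Or.inl fun y hy => ⟨hgoodC y ⟨hy.2, hy.1.2⟩, hall y ⟨hy.2, hy.1⟩⟩
      · refine Or.inr fun y hy hgood => hnone y ⟨hy.2, hy.1⟩ hgood.2
    · exact Or.inr fun y hy hgood => hbadC y ⟨hy.2, hy.1.2⟩ hgood.1

end FromVerdier

end HodgeTheory

end Literature.AlgebraicGeometry.HodgeTheory

end
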